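import Mathlib
import Summits.Ventures.PercRepro2.Defs
import Summits.Ventures.PercRepro2.Graph
import Summits.Ventures.PercRepro2.OneColourSwitch
import Summits.Ventures.PercRepro2.RegionHubSign
import Summits.Ventures.PercRepro2.SideSwitch
import Summits.Ventures.PercRepro2.SideSwitchFibre
import Summits.Ventures.PercRepro2.SideSwitchMono
import Summits.Ventures.PercRepro2.SideSwitchM9
import Summits.Ventures.PercRepro2.SideSwitchClosed
import Summits.Ventures.PercRepro2.SideSwitchComps
import Summits.Ventures.PercRepro2.TermSwitchDefs
import Summits.Ventures.PercRepro2.TermSwitchFibre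
import Summits.Ventures.PercRepro2.TermSwitchCompsFibre
import Summits.Ventures.PercRepro2.TermSwitchMono
import Summits.Ventures.PercRepro2.TermSwitchM9

/-!
# The terminal-set theorem restricted to a fibre-invariant predicate (blind cell PercRepro2,
p3 g21, 2026-08-27; `proofs/P3-CPNC.md` §18h)

The Harris step of `TermSwitchM9` runs fibre by fibre: for a predicate `P` on colourings that is
constant along the component assignments of every representative and invariant under the
outside flip, `Σ_{ω ∈ Sep_H ∩ DZero_H, P ω} σ_pq · σ_rs ≤ 0` (`dzeroSignSumHP_nonpos`) — the
per-representative inequality `fibre_sum_nonpos` is the one of `dzeroSignSumH_nonpos`, stated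
on its own.  Own work; std axioms.
-/

namespace Summit.Ventures.PercRepro2

namespace TermSwitch

open Finset Classical RegionHub OneColourSwitch SideSwitch

variable {V : Type*} {E : Type*}

section Count

variable [Fintype V] [DecidableEq V] [Fintype E] [DecidableEq E]

variable {ends : E → Sym2 V}

/-- **The per-representative Harris step**: for a representative `ρ` and a terminal `r`,
`Σ_T (σ_pq(ρ_T) + σ_pq(ρ^O_T)) · σ_rs(ρ_T) ≤ 0`. -/
lemma fibre_sum_nonpos {p q : V} {H : Set V} {ρ : Config E} (hρ : ρ ∈ RepH ends p q H)
    {r : V} (hr : r ∈ H) (s : V) :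
    ∑ T ∈ (compsH ends H ρ).powerset,
      (sigma ends (assignC ends T ρ) p q + sigma ends (assignC ends T (flipOH ends H ρ)) p q) *
        sigma ends (assignC ends T ρ) r s ≤ 0 := by
  set A := compsH ends H ρ with hA
  let Yc : Finset (Finset V) → ℤ := fun T => if Conn ends (assignC ends T ρ) p q then 1 else 0
  let Yc' : Finset (Finset V) → ℤ := fun T =>
    if Conn ends (assignC ends T (flipOH ends H ρ)) p q then 1 else 0
  let G : Finset (Finset V) → ℤ := fun T => Yc T + Yc' T
  let D : Finset (Finset V) → ℤ := fun T => G T - G (A \ T)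
  let S : Finset (Finset V) → ℤ := fun T => sigma ends (assignC ends T ρ) r s
  have hρO := flipOH_mem_RepH hρ
  have hmonoYc : ∀ T T', T ⊆ T' → T' ⊆ A → Yc T ≤ Yc T' := by
    intro T T' hTT hT'
    exact ite_le_ite_of_imp (conn_pq_assignC_mono_H hρ hTT hT')
  have hmonoYc' : ∀ T T', T ⊆ T' → T' ⊆ A → Yc' T ≤ Yc' T' := by
    intro T T' hTT hT'
    have hT'O : T' ⊆ compsH ends H (flipOH ends H ρ) := by rw [compsH_flipOH]; exact hT'
    exact ite_le_ite_of_imp (conn_pq_assignC_mono_H hρO hTT hT'O)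
  have hmonoD : ∀ T T', T ⊆ T' → T' ⊆ A → D T ≤ D T' := by
    intro T T' hTT hT'
    have h1 := hmonoYc T T' hTT hT'
    have h2 := hmonoYc' T T' hTT hT'
    have h3 := hmonoYc (A \ T') (A \ T) (Finset.sdiff_subset_sdiff (Finset.Subset.refl A) hTT)
      Finset.sdiff_subset
    have h4 := hmonoYc' (A \ T') (A \ T) (Finset.sdiff_subset_sdiff (Finset.Subset.refl A) hTT)
      Finset.sdiff_subset
    simp only [D, G]
    linarith
  have hantiS : ∀ T T', T ⊆ T' → T' ⊆ A → S T' ≤ S T := by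
    intro T T' hTT hT'
    show sigma ends (assignC ends T' ρ) r s ≤ sigma ends (assignC ends T ρ) r s
    unfold sigma
    exact sub_le_sub (ite_le_ite_of_imp (conn_rs_assignC_anti_H hρ hr s hTT hT'))
      (ite_le_ite_of_imp (conn_rs_compl_assignC_mono_H hρ hr s hTT hT'))
  have h0 : ∑ T ∈ A.powerset, D T = 0 := by
    simp only [D]
    rw [Finset.sum_sub_distrib, sum_powerset_sdiff, sub_self]
  have hH := sum_mul_nonpos_of_monotone_antitone A D S hmonoD hantiS h0
  refine le_trans (le_of_eq ?_) hH
  refine Finset.sum_congr rfl (fun T hT => ?_)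
  rw [sigma_pq_add_flipOH_C hρ (Finset.mem_powerset.1 hT)]

/-- The terminal-set sign sum restricted to a predicate `P`:
`Σ_{ω ∈ Sep_H ∩ DZero_H, P ω} σ_pq · σ_rs`. -/
noncomputable def dzeroSignSumHP (ends : E → Sym2 V) (p q r s : V) (H : Set V)
    (P : Config E → Prop) : ℤ :=
  ∑ ω : Config E, if sepH ends p q H ω ∧ DZeroH ends H ω ∧ P ω then
    sigma ends ω p q * sigma ends ω r s else 0

/-- **The terminal-set theorem restricted to a fibre-invariant predicate**: for `P` constant
along the component assignments of every representative and invariant under the outside flip,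
`Σ_{ω ∈ Sep_H ∩ DZero_H, P ω} σ_pq · σ_rs ≤ 0`. -/
theorem dzeroSignSumHP_nonpos (p q : V) {r : V} (s : V) {H : Set V} (hr : r ∈ H)
    (P : Config E → Prop)
    (hPa : ∀ ρ ∈ RepH ends p q H, ∀ T ⊆ compsH ends H ρ, (P (assignC ends T ρ) ↔ P ρ))
    (hPO : ∀ ρ ∈ RepH ends p q H, (P (flipOH ends H ρ) ↔ P ρ)) :
    dzeroSignSumHP ends p q r s H P ≤ 0 := by
  -- the fibration, with the predicate pulled out of the inner sum
  have hsum : dzeroSignSumHP ends p q r s H P =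
      ∑ ρ ∈ RepH ends p q H, if P ρ then ∑ T ∈ (compsH ends H ρ).powerset,
        sigma ends (assignC ends T ρ) p q * sigma ends (assignC ends T ρ) r s else 0 := by
    have h1 : dzeroSignSumHP ends p q r s H P =
        ∑ ω ∈ DZeroSetH ends p q H, if P ω then sigma ends ω p q * sigma ends ω r s else 0 := by
      have hset : DZeroSetH ends p q H =
          univ.filter (fun ω => sepH ends p q H ω ∧ DZeroH ends H ω) := by
        ext ω; simp [DZeroSetH, SepSetH]
      rw [hset, Finset.sum_filter, dzeroSignSumHP]
      refine Finset.sum_congr rfl (fun ω _ => ?_)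
      by_cases h1 : sepH ends p q H ω ∧ DZeroH ends H ω
      · by_cases h2 : P ω
        · rw [if_pos ⟨h1.1, h1.2, h2⟩, if_pos h1, if_pos h2]
        · rw [if_neg (fun h => h2 h.2.2), if_pos h1, if_neg h2]
      · rw [if_neg (fun h => h1 ⟨h.1, h.2.1⟩), if_neg h1]
    rw [h1, sum_dzeroH_eq_sum_repH_comps (fun ω => if P ω then sigma ends ω p q *
      sigma ends ω r s else 0)]
    refine Finset.sum_congr rfl (fun ρ hρ => ?_)
    by_cases hP : P ρ
    · rw [if_pos hP]
      refine Finset.sum_congr rfl (fun T hT => ?_)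
      rw [if_pos ((hPa ρ hρ T (Finset.mem_powerset.1 hT)).2 hP)]
    · rw [if_neg hP]
      refine Finset.sum_eq_zero (fun T hT => ?_)
      rw [if_neg (fun h => hP ((hPa ρ hρ T (Finset.mem_powerset.1 hT)).1 h))]
  have hsumO : (∑ ρ ∈ RepH ends p q H, if P ρ then ∑ T ∈ (compsH ends H ρ).powerset,
        sigma ends (assignC ends T ρ) p q * sigma ends (assignC ends T ρ) r s else 0) =
      ∑ ρ ∈ RepH ends p q H, if P ρ then ∑ T ∈ (compsH ends H ρ).powerset,
        sigma ends (assignC ends T (flipOH ends H ρ)) p q *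
          sigma ends (assignC ends T ρ) r s else 0 := by
    symm
    refine Finset.sum_nbij' (fun ρ => flipOH ends H ρ) (fun ρ => flipOH ends H ρ)
      (fun ρ hρ => flipOH_mem_RepH hρ) (fun ρ hρ => flipOH_mem_RepH hρ)
      (fun ρ _ => flipOH_flipOH H ρ) (fun ρ _ => flipOH_flipOH H ρ) ?_
    intro ρ hρ
    rw [compsH_flipOH]
    by_cases hP : P ρ
    · rw [if_pos hP, if_pos ((hPO ρ hρ).2 hP)]
      refine Finset.sum_congr rfl (fun T hT => ?_)
      rw [sigma_rs_assignC_flipOH hr s (Finset.mem_powerset.1 hT)]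
    · rw [if_neg hP, if_neg (fun h => hP ((hPO ρ hρ).1 h))]
  have hkey : ∀ ρ ∈ RepH ends p q H,
      (if P ρ then ∑ T ∈ (compsH ends H ρ).powerset,
        (sigma ends (assignC ends T ρ) p q +
          sigma ends (assignC ends T (flipOH ends H ρ)) p q) *
          sigma ends (assignC ends T ρ) r s else 0) ≤ 0 := by
    intro ρ hρ
    by_cases hP : P ρ
    · rw [if_pos hP]; exact fibre_sum_nonpos hρ hr s
    · rw [if_neg hP]
  have htwice : 2 * dzeroSignSumHP ends p q r s H P ≤ 0 := by
    calc 2 * dzeroSignSumHP ends p q r s H P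
        = dzeroSignSumHP ends p q r s H P + dzeroSignSumHP ends p q r s H P := by ring
      _ = (∑ ρ ∈ RepH ends p q H, if P ρ then ∑ T ∈ (compsH ends H ρ).powerset,
            sigma ends (assignC ends T ρ) p q * sigma ends (assignC ends T ρ) r s else 0) +
          ∑ ρ ∈ RepH ends p q H, if P ρ then ∑ T ∈ (compsH ends H ρ).powerset,
            sigma ends (assignC ends T (flipOH ends H ρ)) p q *
              sigma ends (assignC ends T ρ) r s else 0 := by
          rw [← hsumO, ← hsum]
      _ = ∑ ρ ∈ RepH ends p q H, if P ρ then ∑ T ∈ (compsH ends H ρ).powerset,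
            (sigma ends (assignC ends T ρ) p q +
              sigma ends (assignC ends T (flipOH ends H ρ)) p q) *
              sigma ends (assignC ends T ρ) r s else 0 := by
          rw [← Finset.sum_add_distrib]
          refine Finset.sum_congr rfl (fun ρ _ => ?_)
          by_cases hP : P ρ
          · simp only [if_pos hP]
            rw [← Finset.sum_add_distrib]
            refine Finset.sum_congr rfl (fun T _ => ?_)
            ring
          · simp only [if_neg hP, add_zero]
      _ ≤ 0 := Finset.sum_nonpos (fun ρ hρ => hkey ρ hρ)
  linarith

end Count

end TermSwitch

end Summit.Ventures.PercRepro2
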